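import Literature.Analysis.FluidPDE.HardSphereCollisionRecord
import Literature.Analysis.FluidPDE.HardSphereFlowMeasurable
import Literature.MathematicalPhysics.KineticTheory.HardSphereTwoTimePressure
import Literature.MathematicalPhysics.KineticTheory.HardSphereEulerProofs

/-!
# Vocabulary of the line `coarse-coin-entropy-chain` for the crux `EquilibriumClampedCollisionalWindowLD`
(stmt-AtomisticToContinuum-13733; TwoClocks rank 3 / OneFlightGossipEngine rank 5 — byte-identical route decls)

Definitions-only support file (`--supports stmt-AtomisticToContinuum-13733`) of the line lead
(`Cruxes/EquilibriumClampedCollisionalWindowLD/Lines/coarse_coin_entropy_chain.lean`, planner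
`planner-cruxplan-stmt-AtomisticToContinuum-13733-coarse-coin-entropy--0`; skeleton registered on the item with the six stubs
`stub_predictableHoeffdingChain`, `stub_adaptedClampKinematics`, `stub_activityOverflowLD`, `stub_coinBudgetLD`,
`stub_compensatorDefectLD`, `stub_rateWindowLD`). It makes the line's vocabulary IMPORTABLE so that each registered stub can land
in its own sorry-free Theorems file with the registered signature verbatim. All bodies are copied byte-for-byte from the planner's
skeleton §0–§2; nothing is asserted here (no `def … : Prop`, no statement of the crux or of its repair C′ — those stay in the
route file / the skeleton).

Objects (window `w = τ (N+1)^{-1/3}`, diameter `ε_N = hsDiameter σ N`, canonical Gibbs law `gibbs` = `localGibbsLaw` with constant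
profiles): the TRANSFER activity summand `impulse` (`‖Δv‖ + |Δ‖v‖²|/2` of the first particle of a record), running activities on the
closed / open running interval (`runAct`, `preAct`), the window-global / adapted / predictable clamps (`flagG`, `flagA`, `flagP`), the
row payloads (`payload`, rows indexed by `Option (Fin 3)`, `none` = energy), the clamped transfers (`Xrow` window-global, `Xa`
adapted), the EOS projections `Arow`, the explicit one-coin compensators `kappaRow` and their predictable sum `Kexp`, the overflow
count `overflowCount`, and the coin bookkeeping (`orbit`, `coinCount`, `coinTime`, `coinMark`, `rangeBase`, `coinRange`, `innov`).
Sources for the compensator constants: Chapman–Cowling 1970 §16.5 (16.5,1)–(2) (flux-weighted hemisphere means; Monte-Carlo checked by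
the planner and the three triagers). prover-line-stmt-AtomisticToContinuum-13733-1, 2026-08-16.
-/

noncomputable section

open MeasureTheory ProbabilityTheory Set Filter
open scoped ENNReal BigOperators
open Literature.Analysis.FluidPDE Literature.MathematicalPhysics.KineticTheory
open Literature.Analysis.FunctionSpaces (Torus.partialDeriv Torus.IsSmooth)

namespace Summit.AtomisticToContinuum.HydrodynamicLimit.Theorems.ClampedTransferCoin

/-! ## § 0 Frame -/

/-- The hard-sphere flows of the crux: `N + 1` spheres of diameter `ε_N = σ (N+1)^{-1/3}` on `𝕋³`. -/
abbrev Flow (σ : ℝ) (N : ℕ) : Type :=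
  HardSphereFlow (Torus.geometry (Fin 3)) (hsDiameter σ N) (N + 1)

/-- Phase space of `N + 1` spheres on `𝕋³`. -/
abbrev Phase (N : ℕ) : Type := Config (N + 1) (Fin 3) T3

/-- Collision records of `N + 1` spheres on `𝕋³`. -/
abbrev Rec (N : ℕ) : Type := HardSphereCollisionRecord (Fin 3) T3 (N + 1)

/-- The homogeneous (canonical) Gibbs law `G_N` of the crux. -/
abbrev gibbs (σ a₀ θ₀ : ℝ) (u₀ : V3) (N : ℕ) (Φ : Flow σ N) : Measure (Phase N) :=
  localGibbsLaw σ (fun _ => a₀) (fun _ => u₀) (fun _ => θ₀) N Φ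

/-- The kinetic window `w = τ (N+1)^{-1/3}` (literally the crux's `w`). -/
def window (τ : ℝ) (N : ℕ) : ℝ := τ * ((N : ℝ) + 1) ^ (-(1 / 3 : ℝ))

/-! ## § 1 Activities, clamps, the four rows, the EOS projections and the explicit compensators -/

/-- THE ACTIVITY SUMMAND of C′: the TRANSFER activity `‖v⁺ - v⁻‖ + |‖v⁺‖² - ‖v⁻‖²|/2` of the first particle of a record
(momentum + energy impulse). The filed crux has `‖v⁺ - v⁻‖` here (and is refuted through that); nothing else in this file refers
to the choice. -/
def impulse {N : ℕ} (c : Rec N) : ℝ :=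
  ‖c.postVel.1 - c.preVel.1‖ + |‖c.postVel.1‖ ^ 2 - ‖c.preVel.1‖ ^ 2| / 2

/-- Running activity of particle `i` on the CLOSED window `(0, t]` (C′'s `act i` is `runAct … (window τ N)`). -/
def runAct (σ τ : ℝ) {N : ℕ} (Φ : Flow σ N) (t : ℝ) (i : Fin (N + 1)) (z : Phase N) : ℝ :=
  σ / τ * Φ.collisionSum (Set.Ioc 0 t) (fun c => if c.fst = i then impulse c else 0) z

/-- Running activity of particle `i` on the OPEN window `(0, t)` (PREDICTABLE at a collision at time `t`). -/
def preAct (σ τ : ℝ) {N : ℕ} (Φ : Flow σ N) (t : ℝ) (i : Fin (N + 1)) (z : Phase N) : ℝ :=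
  σ / τ * Φ.collisionSum (Set.Ioo 0 t) (fun c => if c.fst = i then impulse c else 0) z

/-- The window-global clamp `ω_i = 1{act_i ≤ V}` of C′. -/
def flagG (σ τ V : ℝ) {N : ℕ} (Φ : Flow σ N) (i : Fin (N + 1)) (z : Phase N) : ℝ :=
  if runAct σ τ Φ (window τ N) i z ≤ V then 1 else 0

/-- The ADAPTED (stopping-time) clamp at time `t`: `1{running activity on (0,t] ≤ V}` (card adapted-activity-clamp; CLOSED interval,
so a retained collision carries momentum impulse `≤ Vτ/σ` AND energy impulse `≤ Vτ/σ`). -/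
def flagA (σ τ V : ℝ) {N : ℕ} (Φ : Flow σ N) (t : ℝ) (i : Fin (N + 1)) (z : Phase N) : ℝ :=
  if runAct σ τ Φ t i z ≤ V then 1 else 0

/-- The PREDICTABLE clamp at time `t`: `1{running activity on (0,t) ≤ V}`. -/
def flagP (σ τ V : ℝ) {N : ℕ} (Φ : Flow σ N) (t : ℝ) (i : Fin (N + 1)) (z : Phase N) : ℝ :=
  if preAct σ τ Φ t i z ≤ V then 1 else 0

/-- The payload of a record in row `r`: momentum `k` (`r = some k`): `(φ(x_fst) - φ(x_snd)) (v_fst⁺ - v_fst⁻)_k`; energy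
(`r = none`): `(φ(x_fst) - φ(x_snd)) (‖v_fst⁺‖² - ‖v_fst⁻‖²)/2` (literally the summands of C′'s `Xm k` / `Xe`). -/
def payload {N : ℕ} (φ : T3 → ℝ) : Option (Fin 3) → Rec N → ℝ
  | some k => fun c => (φ c.fstPos - φ c.sndPos) * (c.postVel.1 k - c.preVel.1 k)
  | none => fun c => (φ c.fstPos - φ c.sndPos) * ((‖c.postVel.1‖ ^ 2 - ‖c.preVel.1‖ ^ 2) / 2)

/-- The clamped collisional transfer of C′ in row `r` (window-global clamp; literally C′'s `Xm k` / `Xe`). -/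
def Xrow (σ τ V : ℝ) (φ : T3 → ℝ) {N : ℕ} (Φ : Flow σ N) (r : Option (Fin 3)) (z : Phase N) : ℝ :=
  Φ.collisionSum (Set.Ioc 0 (window τ N))
    (fun c => flagG σ τ V Φ c.fst z * flagG σ τ V Φ c.snd z * payload φ r c / 2) z

/-- The ADAPTED-clamped collisional transfer `X̃` in row `r` (clamp read at the collision time). -/
def Xa (σ τ V : ℝ) (φ : T3 → ℝ) {N : ℕ} (Φ : Flow σ N) (r : Option (Fin 3)) (z : Phase N) : ℝ :=
  Φ.collisionSum (Set.Ioc 0 (window τ N))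
    (fun c => flagA σ τ V Φ c.time c.fst z * flagA σ τ V Φ c.time c.snd z * payload φ r c / 2) z

/-- The EOS projection of C′ in row `r` (literally C′'s `Am k` / `Ae`). -/
def Arow (σ θ₀ : ℝ) (u₀ : V3) (τ : ℝ) (φ : T3 → ℝ) {N : ℕ} (Φ : Flow σ N) : Option (Fin 3) → Phase N → ℝ
  | some k => fun z => ∫ r in (0 : ℝ)..window τ N, ∑ i, Torus.partialDeriv k φ ((Φ.flow r z i).1) *
      (θ₀ * σ ^ 3 * deriv hsCompressibility (σ ^ 3) +
        (1 / 3) * (hsCompressibility (σ ^ 3) - 1) * ‖(Φ.flow r z i).2 - u₀‖ ^ 2)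
  | none => fun z => ∫ r in (0 : ℝ)..window τ N, ∑ i,
      ((∑ l, u₀ l * Torus.partialDeriv l φ ((Φ.flow r z i).1)) *
          (θ₀ * σ ^ 3 * deriv hsCompressibility (σ ^ 3) +
            (1 / 3) * (hsCompressibility (σ ^ 3) - 1) * ‖(Φ.flow r z i).2 - u₀‖ ^ 2) +
        θ₀ * (hsCompressibility (σ ^ 3) - 1) *
          (∑ l, Torus.partialDeriv l φ ((Φ.flow r z i).1) * ((Φ.flow r z i).2 - u₀) l))

/-- THE EXPLICIT ONE-COIN COMPENSATORS per ordered record (half of the per-collision flux-weighted hemisphere means; `g = v_fst⁻ -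
v_snd⁻`, `U = (v_fst⁻ + v_snd⁻)/2`, `∇φ` at `x_fst`): momentum `k`: `(ε_N/15)(2(g·∇φ)g_k + |g|²∂_kφ)/|g|`; energy:
`(ε_N/15)((∇φ·U)|g|² + 2(g·∇φ)(g·U))/|g|`. -/
def kappaRow (σ : ℝ) (φ : T3 → ℝ) (N : ℕ) : Option (Fin 3) → Rec N → ℝ
  | some k => fun c =>
      hsDiameter σ N / 15 *
        (2 * (∑ l, (c.preVel.1 - c.preVel.2) l * Torus.partialDeriv l φ c.fstPos) * (c.preVel.1 - c.preVel.2) k +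
          ‖c.preVel.1 - c.preVel.2‖ ^ 2 * Torus.partialDeriv k φ c.fstPos) / ‖c.preVel.1 - c.preVel.2‖
  | none => fun c =>
      hsDiameter σ N / 15 *
        ((∑ l, ((2 : ℝ)⁻¹ * (c.preVel.1 + c.preVel.2) l) * Torus.partialDeriv l φ c.fstPos) *
            ‖c.preVel.1 - c.preVel.2‖ ^ 2 +
          2 * (∑ l, (c.preVel.1 - c.preVel.2) l * Torus.partialDeriv l φ c.fstPos) *
            (∑ l, (c.preVel.1 - c.preVel.2) l * ((2 : ℝ)⁻¹ * (c.preVel.1 + c.preVel.2) l))) /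
        ‖c.preVel.1 - c.preVel.2‖

/-- The EXPLICIT PREDICTABLE COMPENSATOR `K_exp = Σ_records ω̃⁻ω̃⁻ κ` in row `r` (predictable clamps, explicit one-coin means: a
functional of WHICH collisions happen among not-yet-clamped particles and with what incoming velocities — rates and partner
selection, no impact geometry). -/
def Kexp (σ τ V : ℝ) (φ : T3 → ℝ) {N : ℕ} (Φ : Flow σ N) (r : Option (Fin 3)) (z : Phase N) : ℝ :=
  Φ.collisionSum (Set.Ioc 0 (window τ N))
    (fun c => flagP σ τ V Φ c.time c.fst z * flagP σ τ V Φ c.time c.snd z * kappaRow σ φ N r c) z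

/-- The number of over-budget particles `#{i : act_i > V}` (window-global transfer activity). -/
def overflowCount (σ τ V : ℝ) {N : ℕ} (Φ : Flow σ N) (z : Phase N) : ℕ :=
  (Finset.univ.filter fun i => V < runAct σ τ Φ (window τ N) i z).card

/-! ## § 2 Coins: the collisions of the window in time order, their marks and truncated predictable ranges -/

/-- The orbit of the initial datum `z`. -/
def orbit {σ : ℝ} {N : ℕ} (Φ : Flow σ N) (z : Phase N) : ℝ → Phase N := fun s => Φ.flow s z

/-- The number of collisions (coins) of the whole system in the window `(0, w]` (finite on good orbits). -/
def coinCount (σ τ : ℝ) {N : ℕ} (Φ : Flow σ N) (z : Phase N) : ℕ :=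
  (collisionTimes (Torus.geometry (Fin 3)) (hsDiameter σ N) (orbit Φ z) ∩ Set.Ioc 0 (window τ N)).ncard

/-- The time of the `n`-th coin (`n = 0` the first collision after time `0`; `FluidPDE.nthCollisionTime`). -/
def coinTime {σ : ℝ} {N : ℕ} (Φ : Flow σ N) (z : Phase N) (n : ℕ) : ℝ :=
  nthCollisionTime (Torus.geometry (Fin 3)) (hsDiameter σ N) (orbit Φ z) 0 n

open scoped Classical in
/-- The MARK `T_n` of the `n`-th coin in row `r`: the adapted-clamped transfer of that collision (sum over its two ordered records,
each with the factor `1/2`), guarded by the good set and the coin count (`0` otherwise), so that on good orbits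
`X̃ = Σ_{n < coinCount} T_n`. -/
def coinMark (σ τ V : ℝ) (φ : T3 → ℝ) {N : ℕ} (Φ : Flow σ N) (r : Option (Fin 3)) (n : ℕ) (z : Phase N) : ℝ :=
  if z ∈ Φ.good ∧ n < coinCount σ τ Φ z then
    ∑ p ∈ contactPairs (Torus.geometry (Fin 3)) (hsDiameter σ N) (Φ.flow (coinTime Φ z n) z),
      (fun c : Rec N => flagA σ τ V Φ c.time c.fst z * flagA σ τ V Φ c.time c.snd z * payload φ r c / 2)
        (HardSphereCollisionRecord.ofConfig (Torus.geometry (Fin 3)) (hsDiameter σ N)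
          (Φ.flow (coinTime Φ z n) z) (coinTime Φ z n) p.1 p.2)
  else 0

/-- The kinematic range of a record's payload per unit Lipschitz constant of `φ`, WHATEVER the impact parameter: momentum rows
`ε_N |g|` (`|Δv| = |g·ω̂| ≤ |g|`), energy row `ε_N |g| |U|` (`Δ(‖v_fst‖²/2) = |g·ω̂|(ω̂·U)`, `U = (v_fst⁻ + v_snd⁻)/2`). -/
def rangeBase (σ : ℝ) (N : ℕ) : Option (Fin 3) → Rec N → ℝ
  | some _ => fun c => hsDiameter σ N * ‖c.preVel.1 - c.preVel.2‖
  | none => fun c => hsDiameter σ N * (‖c.preVel.1 - c.preVel.2‖ * ((2 : ℝ)⁻¹ * ‖c.preVel.1 + c.preVel.2‖))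

open scoped Classical in
/-- The TRUNCATED PREDICTABLE RANGE `ρ_n` of the `n`-th coin in row `r`: per ordered record `ω̃⁻ω̃⁻ · min(rangeBase, wV)/2` — the
kinematic range, truncated by the budget the ADAPTED clamp leaves (a retained record has `ε_N·(its impulse) ≤ wV`, so a mark never
exceeds `L w V` whatever the incoming speeds), times the predictable clamps. `|T_n| ≤ L ρ_n` (S2c); a function of the pre-coin
running activities and of the incoming pair velocities only. -/
def coinRange (σ τ V : ℝ) {N : ℕ} (Φ : Flow σ N) (r : Option (Fin 3)) (n : ℕ) (z : Phase N) : ℝ :=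
  if z ∈ Φ.good ∧ n < coinCount σ τ Φ z then
    ∑ p ∈ contactPairs (Torus.geometry (Fin 3)) (hsDiameter σ N) (Φ.flow (coinTime Φ z n) z),
      (fun c : Rec N => flagP σ τ V Φ c.time c.fst z * flagP σ τ V Φ c.time c.snd z *
          min (rangeBase σ N r c) (window τ N * V) / 2)
        (HardSphereCollisionRecord.ofConfig (Torus.geometry (Fin 3)) (hsDiameter σ N)
          (Φ.flow (coinTime Φ z n) z) (coinTime Φ z n) p.1 p.2)
  else 0

/-- The INNOVATION SUM `M_H = Σ_{n<H} (T_n - G_N[T_n | ℱ_n])` of the first `H` coins in row `r` along a filtration `ℱ` of phase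
space (Doob: `X̃ = M_H + K_true,H + tail`). -/
def innov (σ a₀ θ₀ : ℝ) (u₀ : V3) (τ V : ℝ) (φ : T3 → ℝ) {N : ℕ} (Φ : Flow σ N)
    (ℱ : Filtration ℕ (inferInstance : MeasurableSpace (Phase N))) (r : Option (Fin 3)) (H : ℕ) (z : Phase N) : ℝ :=
  ∑ n ∈ Finset.range H,
    (coinMark σ τ V φ Φ r n z - ((gibbs σ a₀ θ₀ u₀ N Φ)[coinMark σ τ V φ Φ r n | ℱ n]) z)


/-- The kinetic window is positive for `τ > 0`. -/
theorem window_pos {τ : ℝ} (hτ : 0 < τ) (N : ℕ) : 0 < window τ N :=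
  mul_pos hτ (Real.rpow_pos_of_pos (by positivity) _)

/-- `ε_N · (τ/σ) = w`: the diameter times the activity normalisation is the window (`σ ≠ 0`). -/
theorem hsDiameter_mul_div (σ τ : ℝ) (hσ : σ ≠ 0) (N : ℕ) :
    hsDiameter σ N * (τ / σ) = window τ N := by
  unfold window hsDiameter
  push_cast
  field_simp

end Summit.AtomisticToContinuum.HydrodynamicLimit.Theorems.ClampedTransferCoin

end
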